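import Summits.AtomisticToContinuum.Crystallization.Theorems.GappedShellCensusTornFreeLocalReduction
import Summits.AtomisticToContinuum.Crystallization.Theorems.GappedShellCensusTornFreeStubTfRescale
import Summits.AtomisticToContinuum.Crystallization.Theorems.GappedShellCensusTornFreeTrichotomyUnit
import Summits.AtomisticToContinuum.Crystallization.Theorems.GappedShellCensusTornFreeSparseSplitUnit

/-!
# Crux `GappedShellCensus.TornFree` (stmt-AtomisticToContinuum-18069) — route-level SPLIT glue

Strategist output (b): the combinatorial trichotomy of a torn bond, promoted from the live line
`Cruxes/TornFree/Lines/Sketch.lean` (v3.4) to a typed decomposition of the crux into FOUR pure,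
unit-scale, origin-based, finite sub-cruxes, with the implication to `TornFree` BY NAME proved
here sorry-free:

`tornFree_of_subs : NoLonelyBondUnit → NoTwinBondUnit → NoHubTriadUnit → NoFarTriadUnit → TornFree`

(the four hypotheses are spelled out inline; they are VERBATIM the statements of the registered
stubs `stub_tfNoLonelyBondUnit`, `stub_tfNoTwinBondUnit`, `stub_tfNoHubTriadUnit`,
`stub_tfNoFarTriadUnit`, so a proof of a child item closes the corresponding stub and conversely).

Common frame of all four: a finite `Y ∋ 0` in `ℝ³`, every pair of distinct points at distance
`≥ 0.98` and either `≤ 1.02` (bond) or `≥ 1.26` (far) (ALLGAP), at most twelve bonded neighbours at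
every site, exactly twelve at every site within `3` of the origin, and a bond `(0, v)`; `c` = the
number of common bonded neighbours of `0` and `v`.
* `NoLonelyBondUnit` : `c ≤ 1` is impossible.  Two-centre allgap numerics: infeasible with margin
  `0.0149` (`c = 1`) / `0.0221` (`c = 0`) of the bond length (kit j022883, j025561) — the most
  certifiable piece (two twelve-coordinated centres suffice numerically).
* `NoTwinBondUnit` : `c ≤ 2` with two distinct commons is impossible.  Two-centre allgap slack
  `−0.0008` only (disprover, word WW); a third centre gives `−0.011`; hard-core-only it is FALSE
  (`TornFree.Negative.StubTwoCentreGeThreeFalse`, 22 points) — ALLGAP at the third site is used.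
* `NoHubTriadUnit` : `c ≤ 3` with commons `w₁ – w₂ – w₃`, hub `w₂` bonded to both (word TTW), is
  impossible.  This is the class of all twelve torn bonds per cell of β-manganese, which is
  all-gapped-twelve and torn at tolerance `29/500` (`TornFree.Negative.BetaMn`, p156018); at `1/50`
  its two-centre cuts miss feasibility by `0.019 – 0.031` (kit j025606).
* `NoFarTriadUnit` : `c ≤ 3` with `w₃` far from `w₁, w₂` (words TWW/WWW) is impossible.  Two-centre
  FEASIBLE (`+0.0035`, the snub-disphenoid hole; `TornFree.Negative.TwoCentre`), third centre
  `−0.0045 … −0.016` — a `≥ 3`-centre certificate with margin `≲ 1.5e-2`; the hardest piece.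

Proof = localisation to the finite ALLGAP patch `Y ∩ B̄(y, 5a)` (`tf_patch_hyps`,
`tf_commons_finite`, p150126) ∘ rescaling about `y` (`stub_tfRescale`, p155348) ∘ trichotomy
(`tf_trichotomyUnit`, p155445) ∘ sparse split (`tf_sparseSplitUnit`, p157060).  No new
definitions, no named facts, no sorries.
-/

noncomputable section

namespace Summit.AtomisticToContinuum.Crystallization.Theorems

open Summit.AtomisticToContinuum.Crystallization.Theses.GappedShellCensus

/-- **Split glue (kernel-checked).** The four unit-scale classes of a torn bond — lonely (`c ≤ 1`),
twin (`c = 2`), hub triad (TTW), far triad (TWW/WWW) — jointly imply the crux `TornFree` by name.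
Intended use: `ledger route edit … --split TornFree --into … --glue-by tornFree_of_subs`. -/
theorem tornFree_of_subs
    (hLonely : ∀ (Y : Set (EuclideanSpace ℝ (Fin 3))), Y.Finite → (0 : EuclideanSpace ℝ (Fin 3)) ∈ Y →
      (∀ p ∈ Y, ∀ q ∈ Y, p ≠ q → 1 - 1 / 50 ≤ dist p q ∧
        (dist p q ≤ 1 + 1 / 50 ∨ 63 / 50 ≤ dist p q)) →
      (∀ z ∈ Y, {w ∈ Y | w ≠ z ∧ dist z w ≤ 1 + 1 / 50}.ncard ≤ 12) →
      (∀ z ∈ Y, ‖z‖ ≤ 3 → {w ∈ Y | w ≠ z ∧ dist z w ≤ 1 + 1 / 50}.ncard = 12) →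
      ∀ v ∈ Y, v ≠ 0 → ‖v‖ ≤ 1 + 1 / 50 →
        {w ∈ Y | w ≠ 0 ∧ w ≠ v ∧ ‖w‖ ≤ 1 + 1 / 50 ∧ dist v w ≤ 1 + 1 / 50}.ncard ≤ 1 →
        False)
    (hTwin : ∀ (Y : Set (EuclideanSpace ℝ (Fin 3))), Y.Finite → (0 : EuclideanSpace ℝ (Fin 3)) ∈ Y →
      (∀ p ∈ Y, ∀ q ∈ Y, p ≠ q → 1 - 1 / 50 ≤ dist p q ∧
        (dist p q ≤ 1 + 1 / 50 ∨ 63 / 50 ≤ dist p q)) →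
      (∀ z ∈ Y, {w ∈ Y | w ≠ z ∧ dist z w ≤ 1 + 1 / 50}.ncard ≤ 12) →
      (∀ z ∈ Y, ‖z‖ ≤ 3 → {w ∈ Y | w ≠ z ∧ dist z w ≤ 1 + 1 / 50}.ncard = 12) →
      ∀ v ∈ Y, v ≠ 0 → ‖v‖ ≤ 1 + 1 / 50 →
        {w ∈ Y | w ≠ 0 ∧ w ≠ v ∧ ‖w‖ ≤ 1 + 1 / 50 ∧ dist v w ≤ 1 + 1 / 50}.ncard ≤ 2 →
        ∀ w₁ ∈ Y, ∀ w₂ ∈ Y,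
          w₁ ≠ 0 → w₁ ≠ v → ‖w₁‖ ≤ 1 + 1 / 50 → dist v w₁ ≤ 1 + 1 / 50 →
          w₂ ≠ 0 → w₂ ≠ v → ‖w₂‖ ≤ 1 + 1 / 50 → dist v w₂ ≤ 1 + 1 / 50 →
          w₁ ≠ w₂ → False)
    (hHub : ∀ (Y : Set (EuclideanSpace ℝ (Fin 3))), Y.Finite → (0 : EuclideanSpace ℝ (Fin 3)) ∈ Y →
      (∀ p ∈ Y, ∀ q ∈ Y, p ≠ q → 1 - 1 / 50 ≤ dist p q ∧
        (dist p q ≤ 1 + 1 / 50 ∨ 63 / 50 ≤ dist p q)) →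
      (∀ z ∈ Y, {w ∈ Y | w ≠ z ∧ dist z w ≤ 1 + 1 / 50}.ncard ≤ 12) →
      (∀ z ∈ Y, ‖z‖ ≤ 3 → {w ∈ Y | w ≠ z ∧ dist z w ≤ 1 + 1 / 50}.ncard = 12) →
      ∀ v ∈ Y, v ≠ 0 → ‖v‖ ≤ 1 + 1 / 50 →
        {w ∈ Y | w ≠ 0 ∧ w ≠ v ∧ ‖w‖ ≤ 1 + 1 / 50 ∧ dist v w ≤ 1 + 1 / 50}.ncard ≤ 3 →
        ∀ w₁ ∈ Y, ∀ w₂ ∈ Y, ∀ w₃ ∈ Y,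
          w₁ ≠ 0 → w₁ ≠ v → ‖w₁‖ ≤ 1 + 1 / 50 → dist v w₁ ≤ 1 + 1 / 50 →
          w₂ ≠ 0 → w₂ ≠ v → ‖w₂‖ ≤ 1 + 1 / 50 → dist v w₂ ≤ 1 + 1 / 50 →
          w₃ ≠ 0 → w₃ ≠ v → ‖w₃‖ ≤ 1 + 1 / 50 → dist v w₃ ≤ 1 + 1 / 50 →
          w₁ ≠ w₂ → w₁ ≠ w₃ → w₂ ≠ w₃ →
          dist w₁ w₂ ≤ 1 + 1 / 50 → dist w₂ w₃ ≤ 1 + 1 / 50 →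
          False)
    (hFar : ∀ (Y : Set (EuclideanSpace ℝ (Fin 3))), Y.Finite → (0 : EuclideanSpace ℝ (Fin 3)) ∈ Y →
      (∀ p ∈ Y, ∀ q ∈ Y, p ≠ q → 1 - 1 / 50 ≤ dist p q ∧
        (dist p q ≤ 1 + 1 / 50 ∨ 63 / 50 ≤ dist p q)) →
      (∀ z ∈ Y, {w ∈ Y | w ≠ z ∧ dist z w ≤ 1 + 1 / 50}.ncard ≤ 12) →
      (∀ z ∈ Y, ‖z‖ ≤ 3 → {w ∈ Y | w ≠ z ∧ dist z w ≤ 1 + 1 / 50}.ncard = 12) →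
      ∀ v ∈ Y, v ≠ 0 → ‖v‖ ≤ 1 + 1 / 50 →
        {w ∈ Y | w ≠ 0 ∧ w ≠ v ∧ ‖w‖ ≤ 1 + 1 / 50 ∧ dist v w ≤ 1 + 1 / 50}.ncard ≤ 3 →
        ∀ w₁ ∈ Y, ∀ w₂ ∈ Y, ∀ w₃ ∈ Y,
          w₁ ≠ 0 → w₁ ≠ v → ‖w₁‖ ≤ 1 + 1 / 50 → dist v w₁ ≤ 1 + 1 / 50 →
          w₂ ≠ 0 → w₂ ≠ v → ‖w₂‖ ≤ 1 + 1 / 50 → dist v w₂ ≤ 1 + 1 / 50 →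
          w₃ ≠ 0 → w₃ ≠ v → ‖w₃‖ ≤ 1 + 1 / 50 → dist v w₃ ≤ 1 + 1 / 50 →
          w₁ ≠ w₂ → w₁ ≠ w₃ → w₂ ≠ w₃ →
          63 / 50 ≤ dist w₁ w₃ → 63 / 50 ≤ dist w₂ w₃ →
          False) :
    TornFree := by
  intro Y a ha hgood y hy v hv hvy hdv
  by_contra hlt
  push Not at hlt
  have h3 : {w ∈ Y | w ≠ y ∧ w ≠ v ∧ dist y w ≤ a * (1 + 1 / 50) ∧
      dist v w ≤ a * (1 + 1 / 50)}.ncard ≤ 3 := by omega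
  -- the finite ALLGAP patch around `y`
  obtain ⟨hfin, hgap, hle, htw⟩ := tf_patch_hyps ha hgood y
  have hyY' : y ∈ {z ∈ Y | dist y z ≤ a * 5} := ⟨hy, by rw [dist_self]; positivity⟩
  have hvY' : v ∈ {z ∈ Y | dist y z ≤ a * 5} := ⟨hv, hdv.trans (by nlinarith)⟩
  have hsubC : {w ∈ {z ∈ Y | dist y z ≤ a * 5} | w ≠ y ∧ w ≠ v ∧ dist y w ≤ a * (1 + 1 / 50) ∧
      dist v w ≤ a * (1 + 1 / 50)} ⊆ {w ∈ Y | w ≠ y ∧ w ≠ v ∧ dist y w ≤ a * (1 + 1 / 50) ∧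
      dist v w ≤ a * (1 + 1 / 50)} := fun w hw => ⟨hw.1.1, hw.2⟩
  have h3' : {w ∈ {z ∈ Y | dist y z ≤ a * 5} | w ≠ y ∧ w ≠ v ∧ dist y w ≤ a * (1 + 1 / 50) ∧
      dist v w ≤ a * (1 + 1 / 50)}.ncard ≤ 3 :=
    (Set.ncard_le_ncard hsubC (tf_commons_finite (hgood y hy).1)).trans h3
  -- rescale about `y` and split by the trichotomy (sparse class split into lonely / twin)
  exact stub_tfRescale
    (tf_trichotomyUnit (tf_sparseSplitUnit hLonely hTwin) hHub hFar)
    _ a ha hfin hgap hle y hyY' htw v hvY' hvy hdv h3'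

end Summit.AtomisticToContinuum.Crystallization.Theorems

end
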